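import Literature.MathematicalPhysics.QuantumFieldTheory.Balaban1983to89.B9Eq310HessianOperator

/-!
# `Balaban1983to89.B9Eq369CurvFormL2` — T. Bałaban, *Propagators for lattice gauge theories in a background field*, Commun. Math. Phys. **99** (1985)
# 389–434 [Balaban1985BackgroundPropagators] (3.69) p. 404 with (3.10) p. 392, (3.2)–(3.4) pp. 390–391, (3.35) p. 396: **THE `L²` SIZE OF THE CURVATURE
# FORM `Δ′` OF (3.10) ON THE CHAIN's CARRIER — `|curvForm τ η U A B| ≤ 384·|DirPair d|·M_τ·η^{d}η⁻²·δ·(Σ_b‖A(b)‖² + Σ_b‖B(b)‖²)` and, for the Riesz operator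
# `curvOp` on `BondL2K`, `|⟪f, Δ′f⟫| ≤ 768·d²·M_τ·M_φ²·(η^d∕c₀)·η⁻²δ·‖f‖²** — from a trace letter `‖τ(XY)‖ ≤ M_τ‖X‖‖Y‖`, `‖X*‖ ≤ ‖X‖`, bond variables in the
# unit balls and the plaquette smallness `‖Re U(∂p) − 1‖, ‖Im U(∂p)‖ ≤ δ` (print's (3.35) ⇒ `δ = O(α₀η²)`): the `L²` letter `p_K = O(α₀)` of the NE9
# owner's plan v11 ((D0-b)∕(D0-c): `re⟪f, Δ′f⟫ ≥ −p_K‖f‖²`), i.e. (3.69) «Δ′(U′U) is a small, bounded operator» in the energy currency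

statement-level skeleton of published theorems with citation tags; proofs where landed; nothing here is a claim about the Yang–Mills mass gap

CITATION HEADER (lean-in-tree rule).  Audit cell `pub-balaban`, sub-cell `t4`, BINDER row NE9; filed by the NE9 BINDER-row OWNER lineage
`b2b-balaban-t4-ne9-p1` (gen 92).  Imports `B9Eq310HessianOperator` only (this lineage g77: `curvOp`, `inner_curvOp`, `toAlg`; through it `B9Eq310DeltaPrime`:
`curvForm`, `curvBlock₁`, `curvBlock₂`, `curlAt`, `edgeLin`, `orderedPairs`, `reHol`, `imHol`).  Sources READ first-hand
(`paper:balaban1985-cmp99-background-propagators`, journal page = PDF page + 388): p. 404 *«Δ(U′U) = D*_{U′U}D_{U′U} + Δ′(U′U). From the formula (3.10) it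
follows that Δ′(U′U) is a small, bounded operator … |(Δ′(U′U)A′)(b)| ≤ O(1)C(L^jη)⁻² …» (3.69)*; p. 392 (3.10); pp. 390–391 (3.2)–(3.4); p. 396 (3.35).  The step
(3.35) ⇒ plaquette smallness is sub-cell b09's `B9Eq335Plaquette` (other carrier) and the abstract-model sup bound is `B9Eq310Hermitian.norm_deltaPrimeOp_le`
∕ `B9Eq369Small`; neither gives the `L²` form on the chain's `BondL2K` — this file does, with crude constants.

WHAT IS PROVED (sorry-free; proof lane — no `def`; [folklore] triangle-inequality counting).  Letters (all DISPLAYED): `hτ : ‖τ(XY)‖ ≤ M_τ‖X‖‖Y‖`,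
`hU : ‖U(b)‖ ≤ 1 ∧ ‖U(b)⁻¹‖ ≤ 1`, `hRe : ‖reHol U p − 1‖ ≤ δ`, `hIm : ‖imHol U p‖ ≤ δ`, `0 ≤ δ`, `0 ≤ M_τ`.
* §1 `norm_conj_le`, `norm_edgeLin_le` (each transported edge variable `≤ E_A(p)` = the sum of the norms of `A` on the four bonds of `∂p`), `norm_curlAt_le`
  (`‖(D^ηA)(p)‖ ≤ ‖η⁻¹‖·4E_A(p)`), `norm_curvBlock₁_le`, `norm_curvBlock₂_le`, `norm_term_le` (one plaquette: `‖η^d(block₁ + block₂)‖ ≤ ‖η^d‖·48M_τ‖η⁻¹‖²δ·E_A·E_B`).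
* §2 counting: `sum_plaq_base_le`, `sum_plaq_shift_le`, `sum_E_sq_le` (`Σ_p E_A(p)² ≤ 16|DirPair d|·Σ_b‖A(b)‖²`), **`norm_curvForm_le`**.
* §3 **`norm_inner_curvOp_self_le`** and **`re_inner_curvOp_self_ge`** — the `L²` floor of `Δ′` on `BondL2K`: `re⟪f, Δ′f⟫ ≥ −p_K‖f‖²`,
  `p_K = 768·d²·M_τ·M_φ²·(η^d∕c₀)·‖η⁻¹‖²·δ` (`M_φ` the norming constant `‖φw‖ ≤ M_φ‖w‖`, `‖X*‖ ≤ ‖X‖`).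
HONEST SCOPE.  Crude constants; the letters stay hypotheses; nothing of [B9] Thm 3.1∕3.3∕3.11 asserted; «NE9 ⇐ the named binders»; NE9 NOT PRINTED ∕ NOT
PROVED; row WALLED ON A MODEL (O-NE9-1; #5 UNRULED); spine PROVED 0∕9; rung (B)+1 on a finite T⁴ — NOT infinite volume, NOT mass gap, NOT BetaPertH, NOT Clay.
HONEST DEPENDENCY: continuum YM on T⁴ ⇐ BetaPertH ∧ nine spine estimates (0/9 proved); BetaPertH ⇐ (D1) ∧ (D4) ∧ CAP+tail.  NEW file; nothing modified.
Net new unproved facts: 0.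
-/

noncomputable section

open scoped InnerProductSpace ComplexConjugate BigOperators
open Finset

namespace Literature.MathematicalPhysics.QuantumFieldTheory.Balaban1983to89.B9Eq369CurvFormL2

open B4Sect5Torus (TSite)
open B9SectCLatticeCarrier (Bond DirPair bpos btgt shift unshift)
open B9Eq33CovDerivVector (shiftEquiv)
open B9Eq311L2Pairing (WL2)
open B11Eq103H1Complex (BondL2K)
open B9Eq310DeltaPrime (reHol imHol edgeLin edgeLin_zero edgeLin_one edgeLin_two edgeLin_three curlAt curlAt_eq_smul_sum_edgeLin orderedPairs
  curvBlock₁ curvBlock₁_apply curvBlock₂ curvBlock₂_apply curvForm curvForm_apply)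
open B9Eq310HessianOperator (curvOp inner_curvOp toAlg)

/-! ## §1 One plaquette -/

section Plaquette

variable {d : ℕ} {Pd : Fin d → ℕ} {𝔸 : Type*} [NormedRing 𝔸] [NormedAlgebra ℂ 𝔸] (τ : 𝔸 →ₗ[ℂ] ℂ) {Mτ : ℝ}
  (hτ : ∀ X Y : 𝔸, ‖τ (X * Y)‖ ≤ Mτ * ‖X‖ * ‖Y‖) (hMτ : 0 ≤ Mτ)
  (η : ℝ) (U : Bond d Pd → 𝔸ˣ) (hU : ∀ b, ‖(U b : 𝔸)‖ ≤ 1 ∧ ‖(((U b)⁻¹ : 𝔸ˣ) : 𝔸)‖ ≤ 1) {δ : ℝ} (hδ : 0 ≤ δ)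
  (hRe : ∀ p : B9SectCLatticeCarrier.Plaq d Pd, ‖reHol U p - 1‖ ≤ δ) (hIm : ∀ p : B9SectCLatticeCarrier.Plaq d Pd, ‖imHol U p‖ ≤ δ)

omit [NormedAlgebra ℂ 𝔸] in
include hU in
/-- `‖U(b)·X·U(b)⁻¹‖ ≤ ‖X‖` for a bond variable in the unit balls. [folklore] [cite: Balaban1985BackgroundPropagators, p.390, (3.35) p.396] -/
theorem norm_conj_le (b : Bond d Pd) (X : 𝔸) : ‖(U b : 𝔸) * X * (((U b)⁻¹ : 𝔸ˣ) : 𝔸)‖ ≤ ‖X‖ := by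
  calc _ ≤ ‖(U b : 𝔸) * X‖ * ‖(((U b)⁻¹ : 𝔸ˣ) : 𝔸)‖ := norm_mul_le _ _
    _ ≤ (‖(U b : 𝔸)‖ * ‖X‖) * ‖(((U b)⁻¹ : 𝔸ˣ) : 𝔸)‖ := mul_le_mul_of_nonneg_right (norm_mul_le _ _) (norm_nonneg _)
    _ ≤ (1 * ‖X‖) * 1 := mul_le_mul (mul_le_mul_of_nonneg_right (hU b).1 (norm_nonneg _)) (hU b).2 (norm_nonneg _) (by positivity)
    _ = ‖X‖ := by ring

include hU in
/-- **Each transported edge variable `A′(b)`, `b ⊂ ∂p`, is bounded by the boundary size `E_A(p)`.** [cite: Balaban1985BackgroundPropagators, (3.2) p.390] -/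
theorem norm_edgeLin_le (A : Bond d Pd → 𝔸) (x : TSite d Pd) (q : DirPair d) (k : Fin 4) :
    ‖edgeLin U (x, q) k A‖ ≤ ‖A (x, q.1.1)‖ + ‖A (x, q.1.2)‖ + ‖A (shift q.1.1 x, q.1.2)‖ + ‖A (shift q.1.2 x, q.1.1)‖ := by
  have h0 := norm_nonneg (A (x, q.1.1)); have h1 := norm_nonneg (A (x, q.1.2))
  have h2 := norm_nonneg (A (shift q.1.1 x, q.1.2)); have h3 := norm_nonneg (A (shift q.1.2 x, q.1.1))
  fin_cases k
  · rw [show ((⟨0, by norm_num⟩ : Fin 4)) = 0 from rfl, edgeLin_zero, norm_neg]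
    exact (norm_conj_le U hU _ _).trans (by linarith)
  · rw [show ((⟨1, by norm_num⟩ : Fin 4)) = 1 from rfl, edgeLin_one, norm_neg]
    linarith
  · rw [show ((⟨2, by norm_num⟩ : Fin 4)) = 2 from rfl, edgeLin_two]
    linarith
  · rw [show ((⟨3, by norm_num⟩ : Fin 4)) = 3 from rfl, edgeLin_three]
    exact (norm_conj_le U hU _ _).trans (by linarith)

include hU in
/-- **`‖(D^ηA)(p)‖ ≤ ‖η⁻¹‖·4E_A(p)`** ((3.4) first form: `η⁻¹` times the four edge variables). [cite: Balaban1985BackgroundPropagators, (3.4) p.391] -/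
theorem norm_curlAt_le (A : Bond d Pd → 𝔸) (x : TSite d Pd) (q : DirPair d) :
    ‖curlAt ((η : ℂ))⁻¹ U (x, q) A‖ ≤
      ‖((η : ℂ))⁻¹‖ * (4 * (‖A (x, q.1.1)‖ + ‖A (x, q.1.2)‖ + ‖A (shift q.1.1 x, q.1.2)‖ + ‖A (shift q.1.2 x, q.1.1)‖)) := by
  rw [curlAt_eq_smul_sum_edgeLin, norm_smul]
  refine mul_le_mul_of_nonneg_left ?_ (norm_nonneg _)
  calc ‖∑ k : Fin 4, edgeLin U (x, q) k A‖ ≤ ∑ k : Fin 4, ‖edgeLin U (x, q) k A‖ := norm_sum_le _ _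
    _ ≤ ∑ _k : Fin 4, (‖A (x, q.1.1)‖ + ‖A (x, q.1.2)‖ + ‖A (shift q.1.1 x, q.1.2)‖ + ‖A (shift q.1.2 x, q.1.1)‖) :=
        Finset.sum_le_sum fun k _ => norm_edgeLin_le U hU A x q k
    _ = 4 * (‖A (x, q.1.1)‖ + ‖A (x, q.1.2)‖ + ‖A (shift q.1.1 x, q.1.2)‖ + ‖A (shift q.1.2 x, q.1.1)‖) := by
        rw [Finset.sum_const, Finset.card_univ, Fintype.card_fin, nsmul_eq_mul]; norm_num

include hτ hMτ in
/-- `‖τ(X·Y·M)‖ ≤ M_τ·‖M‖·‖X‖·‖Y‖` (the trace letter on `X·(YM)`). [folklore] [cite: Balaban1985BackgroundPropagators, (3.10) p.392] -/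
theorem norm_trace_triple_le (X Y M : 𝔸) : ‖τ (X * Y * M)‖ ≤ Mτ * ‖M‖ * ‖X‖ * ‖Y‖ := by
  rw [mul_assoc]
  calc ‖τ (X * (Y * M))‖ ≤ Mτ * ‖X‖ * ‖Y * M‖ := hτ X (Y * M)
    _ ≤ Mτ * ‖X‖ * (‖Y‖ * ‖M‖) := mul_le_mul_of_nonneg_left (norm_mul_le _ _) (by positivity)
    _ = Mτ * ‖M‖ * ‖X‖ * ‖Y‖ := by ring

include hτ hMτ hU hδ hRe in
/-- **The field-strength block**: `‖curvBlock₁ p A B‖ ≤ 16·M_τ·δ·‖η⁻¹‖²·E_A(p)·E_B(p)`. [cite: Balaban1985BackgroundPropagators, (3.10) p.392, (3.69) p.404] -/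
theorem norm_curvBlock₁_le (A B : Bond d Pd → 𝔸) (x : TSite d Pd) (q : DirPair d) :
    ‖curvBlock₁ τ η U (x, q) A B‖ ≤ 16 * Mτ * δ * ‖((η : ℂ))⁻¹‖ ^ 2 *
      (‖A (x, q.1.1)‖ + ‖A (x, q.1.2)‖ + ‖A (shift q.1.1 x, q.1.2)‖ + ‖A (shift q.1.2 x, q.1.1)‖) *
      (‖B (x, q.1.1)‖ + ‖B (x, q.1.2)‖ + ‖B (shift q.1.1 x, q.1.2)‖ + ‖B (shift q.1.2 x, q.1.1)‖) := by
  set EA := ‖A (x, q.1.1)‖ + ‖A (x, q.1.2)‖ + ‖A (shift q.1.1 x, q.1.2)‖ + ‖A (shift q.1.2 x, q.1.1)‖ with hEA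
  set EB := ‖B (x, q.1.1)‖ + ‖B (x, q.1.2)‖ + ‖B (shift q.1.1 x, q.1.2)‖ + ‖B (shift q.1.2 x, q.1.1)‖ with hEB
  have hXA := norm_curlAt_le η U hU A x q
  have hXB := norm_curlAt_le η U hU B x q
  rw [← hEA] at hXA; rw [← hEB] at hXB
  have hM := hRe (x, q)
  have h1 := norm_trace_triple_le τ hτ hMτ (curlAt ((η : ℂ))⁻¹ U (x, q) A) (curlAt ((η : ℂ))⁻¹ U (x, q) B) (reHol U (x, q) - 1)
  have h2 := norm_trace_triple_le τ hτ hMτ (curlAt ((η : ℂ))⁻¹ U (x, q) B) (curlAt ((η : ℂ))⁻¹ U (x, q) A) (reHol U (x, q) - 1)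
  have hEA0 : 0 ≤ EA := by rw [hEA]; positivity
  have hEB0 : 0 ≤ EB := by rw [hEB]; positivity
  have hprod : ‖curlAt ((η : ℂ))⁻¹ U (x, q) A‖ * ‖curlAt ((η : ℂ))⁻¹ U (x, q) B‖ ≤ (‖((η : ℂ))⁻¹‖ * (4 * EA)) * (‖((η : ℂ))⁻¹‖ * (4 * EB)) :=
    mul_le_mul hXA hXB (norm_nonneg _) (by positivity)
  rw [curvBlock₁_apply]
  calc _ ≤ ‖(1 / 2 : ℂ)‖ * (‖τ (curlAt ((η : ℂ))⁻¹ U (x, q) A * curlAt ((η : ℂ))⁻¹ U (x, q) B * (reHol U (x, q) - 1))‖ +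
        ‖τ (curlAt ((η : ℂ))⁻¹ U (x, q) B * curlAt ((η : ℂ))⁻¹ U (x, q) A * (reHol U (x, q) - 1))‖) := by
        rw [norm_mul]; exact mul_le_mul_of_nonneg_left (norm_add_le _ _) (norm_nonneg _)
    _ ≤ (1 / 2) * (Mτ * δ * ((‖((η : ℂ))⁻¹‖ * (4 * EA)) * (‖((η : ℂ))⁻¹‖ * (4 * EB))) +
        Mτ * δ * ((‖((η : ℂ))⁻¹‖ * (4 * EA)) * (‖((η : ℂ))⁻¹‖ * (4 * EB)))) := by
        rw [show ‖(1 / 2 : ℂ)‖ = 1 / 2 by norm_num]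
        refine mul_le_mul_of_nonneg_left (add_le_add ?_ ?_) (by norm_num)
        · calc _ ≤ Mτ * ‖reHol U (x, q) - 1‖ * ‖curlAt ((η : ℂ))⁻¹ U (x, q) A‖ * ‖curlAt ((η : ℂ))⁻¹ U (x, q) B‖ := h1
            _ ≤ Mτ * δ * (‖curlAt ((η : ℂ))⁻¹ U (x, q) A‖ * ‖curlAt ((η : ℂ))⁻¹ U (x, q) B‖) := by
                rw [mul_assoc (Mτ * ‖reHol U (x, q) - 1‖)]
                exact mul_le_mul_of_nonneg_right (mul_le_mul_of_nonneg_left hM hMτ) (by positivity)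
            _ ≤ _ := mul_le_mul_of_nonneg_left hprod (by positivity)
        · calc _ ≤ Mτ * ‖reHol U (x, q) - 1‖ * ‖curlAt ((η : ℂ))⁻¹ U (x, q) B‖ * ‖curlAt ((η : ℂ))⁻¹ U (x, q) A‖ := h2
            _ ≤ Mτ * δ * (‖curlAt ((η : ℂ))⁻¹ U (x, q) A‖ * ‖curlAt ((η : ℂ))⁻¹ U (x, q) B‖) := by
                rw [mul_assoc (Mτ * ‖reHol U (x, q) - 1‖), mul_comm ‖curlAt ((η : ℂ))⁻¹ U (x, q) B‖]
                exact mul_le_mul_of_nonneg_right (mul_le_mul_of_nonneg_left hM hMτ) (by positivity)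
            _ ≤ _ := mul_le_mul_of_nonneg_left hprod (by positivity)
    _ = 16 * Mτ * δ * ‖((η : ℂ))⁻¹‖ ^ 2 * EA * EB := by ring

include hτ hMτ in
/-- `‖τ((XY − YX)·M)‖ ≤ 2M_τ‖M‖‖X‖‖Y‖`. [folklore] [cite: Balaban1985BackgroundPropagators, (3.10) p.392] -/
theorem norm_trace_comm_le (X Y M : 𝔸) : ‖τ ((X * Y - Y * X) * M)‖ ≤ 2 * Mτ * ‖M‖ * ‖X‖ * ‖Y‖ := by
  rw [sub_mul, map_sub]
  have h1 := norm_trace_triple_le τ hτ hMτ X Y M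
  have h2 := norm_trace_triple_le τ hτ hMτ Y X M
  calc _ ≤ ‖τ (X * Y * M)‖ + ‖τ (Y * X * M)‖ := norm_sub_le _ _
    _ ≤ Mτ * ‖M‖ * ‖X‖ * ‖Y‖ + Mτ * ‖M‖ * ‖Y‖ * ‖X‖ := add_le_add h1 h2
    _ = 2 * Mτ * ‖M‖ * ‖X‖ * ‖Y‖ := by ring

/-- `|orderedPairs| ≤ 16`. [folklore] [cite: Balaban1985BackgroundPropagators, (3.2) p.390] -/
theorem card_orderedPairs_le : (orderedPairs.card : ℝ) ≤ 16 := by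
  have h : orderedPairs.card ≤ (Finset.univ : Finset (Fin 4 × Fin 4)).card := Finset.card_le_card (Finset.filter_subset _ _)
  rw [Finset.card_univ, Fintype.card_prod, Fintype.card_fin] at h
  exact_mod_cast h

include hτ hMτ hU hδ hIm in
/-- **The commutator block**: `‖curvBlock₂ p A B‖ ≤ 32·M_τ·δ·‖η⁻¹‖²·E_A(p)·E_B(p)` (each of the `≤ 16` ordered pairs contributes two commutator traces, each
`≤ 2M_τ‖η⁻²Im‖·E_A·E_B`, times `‖i∕2‖ = ½`). [cite: Balaban1985BackgroundPropagators, (3.10) p.392, (3.69) p.404] -/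
theorem norm_curvBlock₂_le (A B : Bond d Pd → 𝔸) (x : TSite d Pd) (q : DirPair d) :
    ‖curvBlock₂ τ η U (x, q) A B‖ ≤ 32 * Mτ * δ * ‖((η : ℂ))⁻¹‖ ^ 2 *
      (‖A (x, q.1.1)‖ + ‖A (x, q.1.2)‖ + ‖A (shift q.1.1 x, q.1.2)‖ + ‖A (shift q.1.2 x, q.1.1)‖) *
      (‖B (x, q.1.1)‖ + ‖B (x, q.1.2)‖ + ‖B (shift q.1.1 x, q.1.2)‖ + ‖B (shift q.1.2 x, q.1.1)‖) := by
  set EA := ‖A (x, q.1.1)‖ + ‖A (x, q.1.2)‖ + ‖A (shift q.1.1 x, q.1.2)‖ + ‖A (shift q.1.2 x, q.1.1)‖ with hEA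
  set EB := ‖B (x, q.1.1)‖ + ‖B (x, q.1.2)‖ + ‖B (shift q.1.1 x, q.1.2)‖ + ‖B (shift q.1.2 x, q.1.1)‖ with hEB
  have hEA0 : 0 ≤ EA := by rw [hEA]; positivity
  have hEB0 : 0 ≤ EB := by rw [hEB]; positivity
  have heA : ∀ k, ‖edgeLin U (x, q) k A‖ ≤ EA := fun k => by rw [hEA]; exact norm_edgeLin_le U hU A x q k
  have heB : ∀ k, ‖edgeLin U (x, q) k B‖ ≤ EB := fun k => by rw [hEB]; exact norm_edgeLin_le U hU B x q k
  set M : 𝔸 := (((η : ℂ))⁻¹) ^ 2 • imHol U (x, q) with hM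
  have hMn : ‖M‖ ≤ ‖((η : ℂ))⁻¹‖ ^ 2 * δ := by
    rw [hM]; refine (norm_smul_le _ _).trans ?_; rw [norm_pow]; exact mul_le_mul_of_nonneg_left (hIm (x, q)) (by positivity)
  set K : ℝ := 2 * Mτ * (‖((η : ℂ))⁻¹‖ ^ 2 * δ) * EA * EB with hK
  have hK0 : 0 ≤ K := by positivity
  have hterm : ∀ kl : Fin 4 × Fin 4, ‖Complex.I / 2 *
      (τ ((edgeLin U (x, q) kl.1 A * edgeLin U (x, q) kl.2 B - edgeLin U (x, q) kl.2 B * edgeLin U (x, q) kl.1 A) * M) +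
        τ ((edgeLin U (x, q) kl.1 B * edgeLin U (x, q) kl.2 A - edgeLin U (x, q) kl.2 A * edgeLin U (x, q) kl.1 B) * M))‖ ≤ K := fun kl => by
    have hI : ‖Complex.I / 2‖ = 1 / 2 := by simp
    have t1 := norm_trace_comm_le τ hτ hMτ (edgeLin U (x, q) kl.1 A) (edgeLin U (x, q) kl.2 B) M
    have t2 := norm_trace_comm_le τ hτ hMτ (edgeLin U (x, q) kl.1 B) (edgeLin U (x, q) kl.2 A) M
    have b1 : 2 * Mτ * ‖M‖ * ‖edgeLin U (x, q) kl.1 A‖ * ‖edgeLin U (x, q) kl.2 B‖ ≤ K := by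
      rw [hK]
      have := mul_le_mul (heA kl.1) (heB kl.2) (norm_nonneg _) hEA0
      have hM2 : 2 * Mτ * ‖M‖ ≤ 2 * Mτ * (‖((η : ℂ))⁻¹‖ ^ 2 * δ) := mul_le_mul_of_nonneg_left hMn (by positivity)
      calc 2 * Mτ * ‖M‖ * ‖edgeLin U (x, q) kl.1 A‖ * ‖edgeLin U (x, q) kl.2 B‖
          = (2 * Mτ * ‖M‖) * (‖edgeLin U (x, q) kl.1 A‖ * ‖edgeLin U (x, q) kl.2 B‖) := by ring
        _ ≤ (2 * Mτ * (‖((η : ℂ))⁻¹‖ ^ 2 * δ)) * (EA * EB) := mul_le_mul hM2 this (by positivity) (by positivity)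
        _ = 2 * Mτ * (‖((η : ℂ))⁻¹‖ ^ 2 * δ) * EA * EB := by ring
    have b2 : 2 * Mτ * ‖M‖ * ‖edgeLin U (x, q) kl.1 B‖ * ‖edgeLin U (x, q) kl.2 A‖ ≤ K := by
      rw [hK]
      have := mul_le_mul (heB kl.1) (heA kl.2) (norm_nonneg _) hEB0
      have hM2 : 2 * Mτ * ‖M‖ ≤ 2 * Mτ * (‖((η : ℂ))⁻¹‖ ^ 2 * δ) := mul_le_mul_of_nonneg_left hMn (by positivity)
      calc 2 * Mτ * ‖M‖ * ‖edgeLin U (x, q) kl.1 B‖ * ‖edgeLin U (x, q) kl.2 A‖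
          = (2 * Mτ * ‖M‖) * (‖edgeLin U (x, q) kl.1 B‖ * ‖edgeLin U (x, q) kl.2 A‖) := by ring
        _ ≤ (2 * Mτ * (‖((η : ℂ))⁻¹‖ ^ 2 * δ)) * (EB * EA) := mul_le_mul hM2 this (by positivity) (by positivity)
        _ = 2 * Mτ * (‖((η : ℂ))⁻¹‖ ^ 2 * δ) * EA * EB := by ring
    rw [norm_mul, hI]
    calc 1 / 2 * ‖τ ((edgeLin U (x, q) kl.1 A * edgeLin U (x, q) kl.2 B - edgeLin U (x, q) kl.2 B * edgeLin U (x, q) kl.1 A) * M) +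
          τ ((edgeLin U (x, q) kl.1 B * edgeLin U (x, q) kl.2 A - edgeLin U (x, q) kl.2 A * edgeLin U (x, q) kl.1 B) * M)‖
        ≤ 1 / 2 * (K + K) := mul_le_mul_of_nonneg_left ((norm_add_le _ _).trans (add_le_add (t1.trans b1) (t2.trans b2))) (by norm_num)
      _ = K := by ring
  rw [curvBlock₂_apply]
  calc _ ≤ ∑ kl ∈ orderedPairs, K := (norm_sum_le _ _).trans (Finset.sum_le_sum fun kl _ => hterm kl)
    _ = orderedPairs.card * K := by rw [Finset.sum_const, nsmul_eq_mul]
    _ ≤ 16 * K := mul_le_mul_of_nonneg_right card_orderedPairs_le hK0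
    _ = 32 * Mτ * δ * ‖((η : ℂ))⁻¹‖ ^ 2 * EA * EB := by rw [hK]; ring

include hτ hMτ hU hδ hRe hIm in
/-- **One plaquette of (3.10)**: `‖η^d·(curvBlock₁ + curvBlock₂)(p)(A, B)‖ ≤ ‖η^d‖·48M_τδ‖η⁻¹‖²·E_A(p)E_B(p)`. [cite: Balaban1985BackgroundPropagators, (3.10) p.392, (3.69) p.404] -/
theorem norm_plaquette_term_le (A B : Bond d Pd → 𝔸) (x : TSite d Pd) (q : DirPair d) :
    ‖((η : ℂ)) ^ d * (curvBlock₁ τ η U (x, q) A B + curvBlock₂ τ η U (x, q) A B)‖ ≤ ‖((η : ℂ)) ^ d‖ * (48 * Mτ * δ * ‖((η : ℂ))⁻¹‖ ^ 2) *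
      ((‖A (x, q.1.1)‖ + ‖A (x, q.1.2)‖ + ‖A (shift q.1.1 x, q.1.2)‖ + ‖A (shift q.1.2 x, q.1.1)‖) *
      (‖B (x, q.1.1)‖ + ‖B (x, q.1.2)‖ + ‖B (shift q.1.1 x, q.1.2)‖ + ‖B (shift q.1.2 x, q.1.1)‖)) := by
  rw [norm_mul, mul_assoc]
  refine mul_le_mul_of_nonneg_left ?_ (norm_nonneg (((η : ℂ)) ^ d))
  have h1 := norm_curvBlock₁_le τ hτ hMτ η U hU hδ hRe A B x q
  have h2 := norm_curvBlock₂_le τ hτ hMτ η U hU hδ hIm A B x q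
  calc _ ≤ ‖curvBlock₁ τ η U (x, q) A B‖ + ‖curvBlock₂ τ η U (x, q) A B‖ := norm_add_le _ _
    _ ≤ _ := (add_le_add h1 h2).trans (le_of_eq (by ring))

end Plaquette

/-! ## §2 The sum over plaquettes -/

section Sum

variable {d : ℕ} {Pd : Fin d → ℕ} {𝔸 : Type*} [NormedRing 𝔸] [NormedAlgebra ℂ 𝔸] (τ : 𝔸 →ₗ[ℂ] ℂ) {Mτ : ℝ}
  (hτ : ∀ X Y : 𝔸, ‖τ (X * Y)‖ ≤ Mτ * ‖X‖ * ‖Y‖) (hMτ : 0 ≤ Mτ)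
  (η : ℝ) (U : Bond d Pd → 𝔸ˣ) (hU : ∀ b, ‖(U b : 𝔸)‖ ≤ 1 ∧ ‖(((U b)⁻¹ : 𝔸ˣ) : 𝔸)‖ ≤ 1) {δ : ℝ} (hδ : 0 ≤ δ)
  (hRe : ∀ p : B9SectCLatticeCarrier.Plaq d Pd, ‖reHol U p - 1‖ ≤ δ) (hIm : ∀ p : B9SectCLatticeCarrier.Plaq d Pd, ‖imHol U p‖ ≤ δ)

/-- COUNTING at the base site: `Σ_p g(p₀, i(q)) ≤ |DirPair d|·Σ_b g(b)` for `g ≥ 0`. [folklore] [cite: Balaban1985BackgroundPropagators, (3.2) p.390] -/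
theorem sum_plaq_base_le (g : Bond d Pd → ℝ) (hg : ∀ b, 0 ≤ g b) (i : DirPair d → Fin d) :
    ∑ p : B9SectCLatticeCarrier.Plaq d Pd, g (p.1, i p.2) ≤ Fintype.card (DirPair d) * ∑ b : Bond d Pd, g b := by
  rw [Fintype.sum_prod_type, Finset.sum_comm, Fintype.sum_prod_type]
  calc ∑ q : DirPair d, ∑ x : TSite d Pd, g (x, i q) ≤ ∑ _q : DirPair d, ∑ y : TSite d Pd, ∑ ν : Fin d, g (y, ν) :=
        Finset.sum_le_sum fun q _ => Finset.sum_le_sum fun y _ =>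
          Finset.single_le_sum (f := fun ν => g (y, ν)) (fun ν _ => hg _) (Finset.mem_univ (i q))
    _ = Fintype.card (DirPair d) * ∑ y : TSite d Pd, ∑ ν : Fin d, g (y, ν) := by rw [Finset.sum_const, nsmul_eq_mul, Finset.card_univ]

/-- COUNTING at a shifted site: `Σ_p g(p₀ + e_{j(q)}, i(q)) ≤ |DirPair d|·Σ_b g(b)` for `g ≥ 0`. [folklore] [cite: Balaban1985BackgroundPropagators, (3.2) p.390] -/
theorem sum_plaq_shift_le (g : Bond d Pd → ℝ) (hg : ∀ b, 0 ≤ g b) (i j : DirPair d → Fin d) :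
    ∑ p : B9SectCLatticeCarrier.Plaq d Pd, g (shift (j p.2) p.1, i p.2) ≤ Fintype.card (DirPair d) * ∑ b : Bond d Pd, g b := by
  rw [Fintype.sum_prod_type, Finset.sum_comm, Fintype.sum_prod_type]
  calc ∑ q : DirPair d, ∑ x : TSite d Pd, g (shift (j q) x, i q) ≤ ∑ _q : DirPair d, ∑ y : TSite d Pd, ∑ ν : Fin d, g (y, ν) := by
        refine Finset.sum_le_sum fun q _ => ?_
        rw [Fintype.sum_equiv (shiftEquiv (j q)) (fun x => g (shift (j q) x, i q)) (fun y => g (y, i q)) (fun x => rfl)]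
        exact Finset.sum_le_sum fun y _ => Finset.single_le_sum (f := fun ν => g (y, ν)) (fun ν _ => hg _) (Finset.mem_univ (i q))
    _ = Fintype.card (DirPair d) * ∑ y : TSite d Pd, ∑ ν : Fin d, g (y, ν) := by rw [Finset.sum_const, nsmul_eq_mul, Finset.card_univ]

omit [NormedAlgebra ℂ 𝔸] in
/-- **`Σ_p E_A(p)² ≤ 16·|DirPair d|·Σ_b ‖A(b)‖²`** (`(a+b+c+e)² ≤ 4(a²+b²+c²+e²)`, then the two countings). [folklore]
[cite: Balaban1985BackgroundPropagators, (3.2) p.390] -/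
theorem sum_edgeSum_sq_le (A : Bond d Pd → 𝔸) :
    ∑ p : B9SectCLatticeCarrier.Plaq d Pd,
        (‖A (p.1, p.2.1.1)‖ + ‖A (p.1, p.2.1.2)‖ + ‖A (shift p.2.1.1 p.1, p.2.1.2)‖ + ‖A (shift p.2.1.2 p.1, p.2.1.1)‖) ^ 2 ≤
      16 * Fintype.card (DirPair d) * ∑ b : Bond d Pd, ‖A b‖ ^ 2 := by
  have h1 := sum_plaq_base_le (Pd := Pd) (fun b => ‖A b‖ ^ 2) (fun b => sq_nonneg _) (fun q => q.1.1)
  have h2 := sum_plaq_base_le (Pd := Pd) (fun b => ‖A b‖ ^ 2) (fun b => sq_nonneg _) (fun q => q.1.2)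
  have h3 := sum_plaq_shift_le (Pd := Pd) (fun b => ‖A b‖ ^ 2) (fun b => sq_nonneg _) (fun q => q.1.2) (fun q => q.1.1)
  have h4 := sum_plaq_shift_le (Pd := Pd) (fun b => ‖A b‖ ^ 2) (fun b => sq_nonneg _) (fun q => q.1.1) (fun q => q.1.2)
  calc _ ≤ ∑ p : B9SectCLatticeCarrier.Plaq d Pd, 4 * (‖A (p.1, p.2.1.1)‖ ^ 2 + ‖A (p.1, p.2.1.2)‖ ^ 2 + ‖A (shift p.2.1.1 p.1, p.2.1.2)‖ ^ 2 +
        ‖A (shift p.2.1.2 p.1, p.2.1.1)‖ ^ 2) := by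
        refine Finset.sum_le_sum fun p _ => ?_
        nlinarith [sq_nonneg (‖A (p.1, p.2.1.1)‖ - ‖A (p.1, p.2.1.2)‖), sq_nonneg (‖A (p.1, p.2.1.1)‖ - ‖A (shift p.2.1.1 p.1, p.2.1.2)‖),
          sq_nonneg (‖A (p.1, p.2.1.1)‖ - ‖A (shift p.2.1.2 p.1, p.2.1.1)‖), sq_nonneg (‖A (p.1, p.2.1.2)‖ - ‖A (shift p.2.1.1 p.1, p.2.1.2)‖),
          sq_nonneg (‖A (p.1, p.2.1.2)‖ - ‖A (shift p.2.1.2 p.1, p.2.1.1)‖), sq_nonneg (‖A (shift p.2.1.1 p.1, p.2.1.2)‖ - ‖A (shift p.2.1.2 p.1, p.2.1.1)‖)]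
    _ = 4 * ((∑ p : B9SectCLatticeCarrier.Plaq d Pd, ‖A (p.1, p.2.1.1)‖ ^ 2) + (∑ p : B9SectCLatticeCarrier.Plaq d Pd, ‖A (p.1, p.2.1.2)‖ ^ 2) +
          (∑ p : B9SectCLatticeCarrier.Plaq d Pd, ‖A (shift p.2.1.1 p.1, p.2.1.2)‖ ^ 2) +
          ∑ p : B9SectCLatticeCarrier.Plaq d Pd, ‖A (shift p.2.1.2 p.1, p.2.1.1)‖ ^ 2) := by
        rw [← Finset.mul_sum]
        simp only [Finset.sum_add_distrib]
    _ ≤ 4 * (Fintype.card (DirPair d) * (∑ b : Bond d Pd, ‖A b‖ ^ 2) + Fintype.card (DirPair d) * (∑ b : Bond d Pd, ‖A b‖ ^ 2) +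
          Fintype.card (DirPair d) * (∑ b : Bond d Pd, ‖A b‖ ^ 2) + Fintype.card (DirPair d) * (∑ b : Bond d Pd, ‖A b‖ ^ 2)) := by
        gcongr
    _ = 16 * Fintype.card (DirPair d) * ∑ b : Bond d Pd, ‖A b‖ ^ 2 := by ring

include hτ hMτ hU hδ hRe hIm in
/-- **THE `L²` SIZE OF THE CURVATURE FORM (3.10)**: for EVERY pair of bond fields,
`‖curvForm τ η U A B‖ ≤ ‖η^d‖·384·|DirPair d|·M_τ·δ·‖η⁻¹‖²·(Σ_b‖A(b)‖² + Σ_b‖B(b)‖²)` — trace letter, bond variables in the unit balls, plaquette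
smallness `‖Re U(∂p) − 1‖, ‖Im U(∂p)‖ ≤ δ`; crude constants. [cite: Balaban1985BackgroundPropagators, (3.10) p.392, (3.69) p.404, (3.35) p.396] -/
theorem norm_curvForm_le (A B : Bond d Pd → 𝔸) :
    ‖curvForm τ η U A B‖ ≤ ‖((η : ℂ)) ^ d‖ * (384 * Fintype.card (DirPair d) * Mτ * δ * ‖((η : ℂ))⁻¹‖ ^ 2) *
      ((∑ b : Bond d Pd, ‖A b‖ ^ 2) + ∑ b : Bond d Pd, ‖B b‖ ^ 2) := by
  set K : ℝ := ‖((η : ℂ)) ^ d‖ * (48 * Mτ * δ * ‖((η : ℂ))⁻¹‖ ^ 2) with hK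
  have hK0 : 0 ≤ K := by positivity
  set EA : B9SectCLatticeCarrier.Plaq d Pd → ℝ := fun p =>
    ‖A (p.1, p.2.1.1)‖ + ‖A (p.1, p.2.1.2)‖ + ‖A (shift p.2.1.1 p.1, p.2.1.2)‖ + ‖A (shift p.2.1.2 p.1, p.2.1.1)‖ with hEA
  set EB : B9SectCLatticeCarrier.Plaq d Pd → ℝ := fun p =>
    ‖B (p.1, p.2.1.1)‖ + ‖B (p.1, p.2.1.2)‖ + ‖B (shift p.2.1.1 p.1, p.2.1.2)‖ + ‖B (shift p.2.1.2 p.1, p.2.1.1)‖ with hEB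
  have hpt : ∀ p : B9SectCLatticeCarrier.Plaq d Pd,
      ‖((η : ℂ)) ^ d * (curvBlock₁ τ η U p A B + curvBlock₂ τ η U p A B)‖ ≤ K * (EA p * EB p) := by
    rintro ⟨x, q⟩
    have h := norm_plaquette_term_le τ hτ hMτ η U hU hδ hRe hIm A B x q
    rw [hK]; exact h.trans (le_of_eq (by ring))
  have hSA := sum_edgeSum_sq_le (Pd := Pd) A
  have hSB := sum_edgeSum_sq_le (Pd := Pd) B
  rw [curvForm_apply]
  calc _ ≤ ∑ p : B9SectCLatticeCarrier.Plaq d Pd, K * (EA p * EB p) := (norm_sum_le _ _).trans (Finset.sum_le_sum fun p _ => hpt p)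
    _ ≤ ∑ p : B9SectCLatticeCarrier.Plaq d Pd, K * ((EA p ^ 2 + EB p ^ 2) / 2) := by
        refine Finset.sum_le_sum fun p _ => mul_le_mul_of_nonneg_left ?_ hK0
        nlinarith [sq_nonneg (EA p - EB p)]
    _ = K / 2 * ((∑ p : B9SectCLatticeCarrier.Plaq d Pd, EA p ^ 2) + ∑ p : B9SectCLatticeCarrier.Plaq d Pd, EB p ^ 2) := by
        rw [← Finset.sum_add_distrib, Finset.mul_sum]
        exact Finset.sum_congr rfl fun p _ => by ring
    _ ≤ K / 2 * (16 * Fintype.card (DirPair d) * (∑ b : Bond d Pd, ‖A b‖ ^ 2) + 16 * Fintype.card (DirPair d) * ∑ b : Bond d Pd, ‖B b‖ ^ 2) := by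
        refine mul_le_mul_of_nonneg_left (add_le_add ?_ ?_) (by positivity)
        · exact hSA
        · exact hSB
    _ = _ := by rw [hK]; ring

end Sum

/-! ## §3 The `L²` floor of the Riesz operator `Δ′` on `BondL2K` -/

section L2

variable {d : ℕ} {Pd : Fin d → ℕ} {𝔸 : Type*} [NormedRing 𝔸] [StarRing 𝔸] [NormedAlgebra ℂ 𝔸] [StarModule ℂ 𝔸]
  {W : Type*} [NormedAddCommGroup W] [InnerProductSpace ℂ W] [FiniteDimensional ℂ W] (φ : W ≃ₗ[ℂ] 𝔸) {Mφ : ℝ}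
  (hφ : ∀ w, ‖φ w‖ ≤ Mφ * ‖w‖) (hstar : ∀ X : 𝔸, ‖star X‖ ≤ ‖X‖)
  {c₀ : ℝ} [Fact (0 < c₀)] (τ : 𝔸 →ₗ[ℂ] ℂ) {Mτ : ℝ} (hτ : ∀ X Y : 𝔸, ‖τ (X * Y)‖ ≤ Mτ * ‖X‖ * ‖Y‖) (hMτ : 0 ≤ Mτ)
  (η : ℝ) (U : Bond d Pd → 𝔸ˣ) (hU : ∀ b, ‖(U b : 𝔸)‖ ≤ 1 ∧ ‖(((U b)⁻¹ : 𝔸ˣ) : 𝔸)‖ ≤ 1) {δ : ℝ} (hδ : 0 ≤ δ)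
  (hRe : ∀ p : B9SectCLatticeCarrier.Plaq d Pd, ‖reHol U p - 1‖ ≤ δ) (hIm : ∀ p : B9SectCLatticeCarrier.Plaq d Pd, ‖imHol U p‖ ≤ δ)

omit [StarModule ℂ 𝔸] [FiniteDimensional ℂ W] [Fact (0 < c₀)] in
include hφ hstar in
/-- The algebra readings `(Φf)*`, `Φf` of an `L²` bond field have `Σ_b‖·‖² ≤ M_φ²·Σ_b‖f(b)‖²` each. [cite: Balaban1985Averaging, (18) p.21] -/
theorem sum_norm_sq_toAlg_le (f : BondL2K ℂ d Pd c₀ W) :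
    (∑ b : Bond d Pd, ‖star (toAlg φ f) b‖ ^ 2) + ∑ b : Bond d Pd, ‖toAlg φ f b‖ ^ 2 ≤
      2 * Mφ ^ 2 * ∑ b : Bond d Pd, ‖WL2.equiv ℂ (fun _ : Bond d Pd => c₀) W f b‖ ^ 2 := by
  have hb : ∀ b : Bond d Pd, ‖toAlg φ f b‖ ≤ Mφ * ‖WL2.equiv ℂ (fun _ : Bond d Pd => c₀) W f b‖ := fun b => hφ _
  have hb' : ∀ b : Bond d Pd, ‖star (toAlg φ f) b‖ ≤ Mφ * ‖WL2.equiv ℂ (fun _ : Bond d Pd => c₀) W f b‖ := fun b =>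
    (hstar _).trans (hb b)
  rw [two_mul, add_mul, Finset.mul_sum]
  refine add_le_add (Finset.sum_le_sum fun b _ => ?_) (Finset.sum_le_sum fun b _ => ?_)
  · calc ‖star (toAlg φ f) b‖ ^ 2 ≤ (Mφ * ‖WL2.equiv ℂ (fun _ : Bond d Pd => c₀) W f b‖) ^ 2 := pow_le_pow_left₀ (norm_nonneg _) (hb' b) 2
      _ = Mφ ^ 2 * ‖WL2.equiv ℂ (fun _ : Bond d Pd => c₀) W f b‖ ^ 2 := by ring
  · calc ‖toAlg φ f b‖ ^ 2 ≤ (Mφ * ‖WL2.equiv ℂ (fun _ : Bond d Pd => c₀) W f b‖) ^ 2 := pow_le_pow_left₀ (norm_nonneg _) (hb b) 2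
      _ = Mφ ^ 2 * ‖WL2.equiv ℂ (fun _ : Bond d Pd => c₀) W f b‖ ^ 2 := by ring

omit [FiniteDimensional ℂ W] in
/-- `Σ_b ‖f(b)‖² = ‖f‖²∕c₀` on the uniformly weighted carrier. [cite: Balaban1985BackgroundPropagators, (3.11) p.392] -/
theorem sum_norm_sq_eq (f : BondL2K ℂ d Pd c₀ W) : ∑ b : Bond d Pd, ‖WL2.equiv ℂ (fun _ : Bond d Pd => c₀) W f b‖ ^ 2 = ‖f‖ ^ 2 / c₀ := by
  have hc₀ : 0 < c₀ := Fact.out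
  rw [WL2.norm_sq, ← Finset.mul_sum, mul_div_cancel_left₀ _ hc₀.ne']

include hφ hstar hτ hMτ hU hδ hRe hIm in
/-- **`|⟪f, Δ′f⟫| ≤ p_K‖f‖²`** with `p_K = 768·|DirPair d|·M_τ·M_φ²·(‖η^d‖∕c₀)·‖η⁻¹‖²·δ` — the `L²` size of the Riesz operator `curvOp` ((3.10) against the
carrier's scalar product, `⟪f, Δ′g⟫ = curvForm((Φf)*, Φg)`). [cite: Balaban1985BackgroundPropagators, (3.10) p.392, (3.69) p.404, (3.35) p.396] -/
theorem norm_inner_curvOp_self_le (f : BondL2K ℂ d Pd c₀ W) :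
    ‖⟪f, curvOp φ τ η U f⟫_ℂ‖ ≤ 768 * Fintype.card (DirPair d) * Mτ * Mφ ^ 2 * (‖((η : ℂ)) ^ d‖ / c₀) * ‖((η : ℂ))⁻¹‖ ^ 2 * δ * ‖f‖ ^ 2 := by
  have hc₀ : 0 < c₀ := Fact.out
  rw [inner_curvOp]
  have h := norm_curvForm_le τ hτ hMτ η U hU hδ hRe hIm (star (toAlg φ f)) (toAlg φ f)
  have hS := sum_norm_sq_toAlg_le φ hφ hstar f
  rw [sum_norm_sq_eq] at hS
  refine h.trans ?_
  have hK0 : 0 ≤ ‖((η : ℂ)) ^ d‖ * (384 * Fintype.card (DirPair d) * Mτ * δ * ‖((η : ℂ))⁻¹‖ ^ 2) := by positivity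
  have hstar_sum : (∑ b : Bond d Pd, ‖star (toAlg φ f) b‖ ^ 2) = ∑ b : Bond d Pd, ‖star (toAlg φ f b)‖ ^ 2 := rfl
  calc _ ≤ ‖((η : ℂ)) ^ d‖ * (384 * Fintype.card (DirPair d) * Mτ * δ * ‖((η : ℂ))⁻¹‖ ^ 2) * (2 * Mφ ^ 2 * (‖f‖ ^ 2 / c₀)) :=
        mul_le_mul_of_nonneg_left hS hK0
    _ = _ := by rw [div_eq_mul_inv, div_eq_mul_inv]; ring

include hφ hstar hτ hMτ hU hδ hRe hIm in
/-- **THE `L²` FLOOR OF `Δ′`**: `re⟪f, Δ′f⟫ ≥ −p_K‖f‖²`, `p_K = 768·|DirPair d|·M_τ·M_φ²·(‖η^d‖∕c₀)·‖η⁻¹‖²·δ` — the `hKre` letter of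
`B9Eq326ConjugatedLocalLetters.coercive_k` ∕ `B9Eq326ConjugatedLocalPart.norm_conjLocalInv_le` for the curvature part of `A₀`; on print's class (3.35)
(`δ = O(α₀η²)`, `c₀ = η^d`) `p_K = O(α₀)`. [cite: Balaban1985BackgroundPropagators, (3.10) p.392, (3.69) p.404, (3.35) p.396] -/
theorem re_inner_curvOp_self_ge (f : BondL2K ℂ d Pd c₀ W) :
    -((768 * Fintype.card (DirPair d) * Mτ * Mφ ^ 2 * (‖((η : ℂ)) ^ d‖ / c₀) * ‖((η : ℂ))⁻¹‖ ^ 2 * δ) * ‖f‖ ^ 2) ≤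
      RCLike.re ⟪f, curvOp φ τ η U f⟫_ℂ := by
  have h := norm_inner_curvOp_self_le φ hφ hstar τ hτ hMτ η U hU hδ hRe hIm f
  have h1 := (abs_le.1 (RCLike.abs_re_le_norm ⟪f, curvOp φ τ η U f⟫_ℂ)).1
  linarith

end L2

end Literature.MathematicalPhysics.QuantumFieldTheory.Balaban1983to89.B9Eq369CurvFormL2

end
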